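import Literature.RepresentationTheory.FiniteGroups.IrreducibleCharacters
import Literature.RepresentationTheory.FiniteGroups.RepresentationRing
import Literature.RepresentationTheory.FiniteGroups.EquivOfCharacter
import Literature.RepresentationTheory.FiniteGroups.InducedInvariantsCharpoly
import HarnessLib

/-!
# Fixed vectors under a normal subgroup of a subgroup: `χ(1) ≤ [G : P] · σ(1)`

Topic `Literature/RepresentationTheory/FiniteGroups`.  Two standard steps of Harish-Chandra's
"philosophy of cusp forms" for a finite group `G` with a subgroup `P` and a normal subgroup
`N ⊴ P` (the model: `P` a parabolic subgroup of `GL_n(𝔽_q)`, `N` its unipotent radical, `P/N`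
the Levi quotient), in the language of the topic files (`irrChars`, `classInner`, `indClassFun`):

* `apply_one_le_index_mul_of_classInner_ne_zero` — **degrees of constituents of an induced
  character**: if `σ` is an irreducible character of `P ≤ G` and the irreducible character `χ` of
  `G` satisfies `⟨Res_P χ, σ⟩_P ≠ 0`, then `χ(1) ≤ [G : P] σ(1)`.  Proof: by Frobenius reciprocity
  (`classInner_indClassFun_left`) `m = ⟨Ind σ, χ⟩_G = ⟨σ, Res χ⟩_P` is a positive integer; the class
  function `Ind_P^G σ = ∑_{χ'} ⟨Ind σ, χ'⟩ χ'` (`IsClassFun.eq_sum_classInner_smul`) has all its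
  coefficients `⟨σ, Res χ'⟩_P ∈ ℕ` (`IsCharacter.classInner_irrChar_natCast`), so
  `[G:P] σ(1) = Ind σ (1) ≥ m χ(1) ≥ χ(1)` (Serre, *Linear Representations of Finite Groups*,
  §7.2; Isaacs, *Character Theory of Finite Groups*, (5.3)–(5.4) and Lemma 5.11's degree count).
* `exists_irrChar_trivial_of_sum_ne_zero` — **fixed vectors of `N` give a constituent inflated
  from `P/N`**: if `∑_{n ∈ N} χ(n) ≠ 0` (i.e. `⟨Res_N χ, 1_N⟩_N ≠ 0`: the space `V^N` of
  `N`-fixed vectors of the representation `V` affording `χ` is non-zero, Serre §2.6), then there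
  is an irreducible character `σ` of `P` which is trivial on `N` (`σ(n x) = σ(x)`) with
  `⟨Res_P χ, σ⟩_P ≠ 0`, hence `χ(1) ≤ [G : P] σ(1)`.  Proof: `V^N ≠ 0` by the averaging formula
  `|N| dim V^N = ∑_{n ∈ N} χ(n)` (`card_mul_trace_restrict_invariants`); `V^N` is `P`-stable because
  `N ⊴ P`; an irreducible `P`-subrepresentation `W ≤ V^N` (`Representation.exists_ne_bot_isIrreducible`)
  has character `σ` trivial on `N`, and `Res_P χ = σ + χ_{W'}` for a Maschke complement `W'`
  (`Representation.character_eq_add_of_isCompl`), so `⟨Res_P χ, σ⟩ = 1 + ⟨χ_{W'}, σ⟩ ≥ 1`.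

* `exists_irreducible_trivial_of_sum_ne_zero`, `exists_irrChar_comp_of_surjective`,
  `exists_irrChar_quotient_of_sum_ker_ne_zero` — the representation-level form (an irreducible
  `P`-representation on which `N` acts trivially), inflation through a surjection `π : P ↠ L` whose
  kernel acts trivially, and the combined statement for `N = ker π`: some irreducible character `σ'`
  of `L` has `σ' ∘ π` occurring in `Res_P χ`, and `χ(1) ≤ [G : P] σ'(1)`.

This is the finite-group skeleton of the statement "an irreducible representation with a
non-zero vector fixed under the unipotent radical `U_P` of a parabolic `P = L U_P` is a constituent
of the parabolic induction `Ind_P^G (infl σ)` of an irreducible representation `σ` of the Levi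
quotient `L`, and its degree is at most `[G : P] σ(1)`" (Carter, *Finite Groups of Lie Type*,
§9.1; Digne–Michel, *Representations of Finite Groups of Lie Type*, Ch. 6), used for the degree
bound of `GLnCharacterDegreeBound`.  Everything here is proved; no definition is introduced.

## References

* J.-P. Serre, *Linear Representations of Finite Groups*, GTM 42 (1977), §2.3 Thm. 4, §2.6,
  §7.2 Thm. 13 [SerreLinearRepresentations1977].
-/

noncomputable section

open scoped BigOperators
open Module

namespace Literature.RepresentationTheory.FiniteGroups

variable {G : Type} [Group G] [Fintype G]

/-! ### Degrees of the constituents of an induced irreducible character -/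

/-- The value at `1` of an irreducible character is a natural number (its degree); local copy of
`IsIrrChar.exists_apply_one_eq_natCast` (declared in `Literature/NumberTheory/LFunctions/HeilbronnBound`,
not imported here). [folklore] -/
private theorem irrChar_apply_one_natCast {K : Type} [Group K] {χ : K → ℂ} (h : IsIrrChar K χ) :
    ∃ d : ℕ, χ 1 = d := by
  obtain ⟨d, -, hd⟩ := h.exists_apply_one
  exact ⟨d, hd⟩

/-- **Degrees of constituents of an induced character.**  Let `P ≤ G` be finite groups, `σ` an
irreducible character of `P` and `χ` an irreducible character of `G` with `⟨Res_P χ, σ⟩_P ≠ 0`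
(equivalently, by Frobenius reciprocity, `χ` is a constituent of `Ind_P^G σ`).  Then
`χ(1) ≤ [G : P] · σ(1)`, stated with the degrees as natural numbers.
(Serre, *Linear Representations*, §7.2 Thm. 13 with §2.3 Thm. 4.) [folklore] -/
theorem apply_one_le_index_mul_of_classInner_ne_zero (P : Subgroup G) [Fintype P]
    {σ : P → ℂ} (hσ : σ ∈ irrChars P) {χ : G → ℂ} (hχ : χ ∈ irrChars G)
    (hm : classInner (fun x : P => χ x) σ ≠ 0) :
    ∃ d e : ℕ, χ 1 = d ∧ σ 1 = e ∧ d ≤ P.index * e := by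
  classical
  have hχi : IsIrrChar G χ := hχ
  have hσi : IsIrrChar P σ := hσ
  obtain ⟨d, hd⟩ := irrChar_apply_one_natCast hχi
  obtain ⟨e, he⟩ := irrChar_apply_one_natCast hσi
  refine ⟨d, e, hd, he, ?_⟩
  -- the induced class function and its Fourier coefficients
  set f : G → ℂ := indClassFun P σ with hf
  have hfcl : IsClassFun f := isClassFun_indClassFun P σ
  -- coefficients are natural numbers: `⟨Ind σ, χ'⟩ = ⟨σ, Res χ'⟩ ∈ ℕ`
  have hcoef : ∀ χ' : G → ℂ, IsIrrChar G χ' → ∃ n : ℕ, classInner f χ' = n := by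
    intro χ' hχ'
    rw [hf, classInner_indClassFun_left P σ hχ'.isCharacter.isClassFun, classInner_comm]
    exact (hχ'.isCharacter.restrict P).classInner_irrChar_natCast hσi
  -- the coefficient of `χ` is a positive natural number
  obtain ⟨m, hmeq⟩ := hcoef χ hχi
  have hm' : classInner f χ = classInner (fun x : P => χ x) σ := by
    rw [hf, classInner_indClassFun_left P σ hχi.isCharacter.isClassFun, classInner_comm]
  have hm1 : 1 ≤ m := by
    rcases Nat.eq_zero_or_pos m with h0 | h0
    · exfalso
      apply hm
      rw [← hm', hmeq, h0, Nat.cast_zero]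
    · exact h0
  -- evaluate the Fourier expansion at `1`
  set F := (irrChars_finite_holds G).toFinset with hF
  have hexp := congrFun hfcl.eq_sum_classInner_smul 1
  simp only [Finset.sum_apply, Pi.smul_apply, smul_eq_mul] at hexp
  -- every term is a non-negative real; the `χ`-term is `m · d`
  have hterm : ∀ χ' ∈ F, ∃ a b : ℕ, classInner f χ' * χ' 1 = (a * b : ℕ) := by
    intro χ' hχ'
    have hχ'i : IsIrrChar G χ' := (irrChars_finite_holds G).mem_toFinset.mp hχ'
    obtain ⟨a, ha⟩ := hcoef χ' hχ'i
    obtain ⟨b, hb⟩ := irrChar_apply_one_natCast hχ'i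
    exact ⟨a, b, by rw [ha, hb, Nat.cast_mul]⟩
  choose! a b hab using hterm
  have hsum : f 1 = ((∑ χ' ∈ F, a χ' * b χ' : ℕ) : ℂ) := by
    rw [hexp, Nat.cast_sum]
    exact Finset.sum_congr rfl fun χ' hχ' => hab χ' hχ'
  have hχF : χ ∈ F := (irrChars_finite_holds G).mem_toFinset.mpr hχi
  -- the `χ`-term
  have hχterm : a χ * b χ = m * d := by
    have h1 := hab χ hχF
    rw [hmeq, hd, ← Nat.cast_mul] at h1
    exact (Nat.cast_injective h1).symm
  have hle1 : m * d ≤ ∑ χ' ∈ F, a χ' * b χ' := by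
    rw [← hχterm]
    exact Finset.single_le_sum (f := fun χ' => a χ' * b χ') (fun χ' _ => Nat.zero_le _) hχF
  -- `f 1 = [G:P] σ(1)`
  have hf1 : f 1 = (P.index * e : ℕ) := by
    rw [hf, indClassFun_one]
    have h1 : σ ⟨1, P.one_mem⟩ = σ 1 := rfl
    rw [h1, he]
    have hP : (Nat.card P : ℂ) ≠ 0 := Nat.cast_ne_zero.mpr Nat.card_pos.ne'
    have hidx : (Fintype.card G : ℂ) = ((P.index * Nat.card P : ℕ) : ℂ) := by
      rw [← Nat.card_eq_fintype_card, ← Subgroup.card_mul_index P, mul_comm]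
    rw [hidx]
    push_cast
    field_simp
  have hfin : m * d ≤ P.index * e := by
    have h : ((∑ χ' ∈ F, a χ' * b χ' : ℕ) : ℂ) = ((P.index * e : ℕ) : ℂ) := hsum.symm.trans hf1
    exact hle1.trans_eq (Nat.cast_injective h)
  calc d ≤ m * d := Nat.le_mul_of_pos_left d hm1
    _ ≤ P.index * e := hfin

/-! ### Fixed vectors of a normal subgroup of `P` -/

/-- **Fixed vectors give a constituent trivial on `N`.**  Let `P ≤ G` be finite groups, `N ⊴ P`,
and `χ` an irreducible character of `G` with `∑_{n ∈ N} χ(n) ≠ 0` (the representation affording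
`χ` has a non-zero `N`-fixed vector, Serre §2.6).  Then some irreducible character `σ` of `P` is
trivial on `N` (`σ(n x) = σ(x)`, i.e. inflated from `P/N`) and occurs in `Res_P χ`
(`⟨Res_P χ, σ⟩_P ≠ 0`); consequently `χ(1) ≤ [G : P] σ(1)`
(`apply_one_le_index_mul_of_classInner_ne_zero`).  (Harish-Chandra; Serre §2.6, §7.2.) [folklore] -/
theorem exists_irrChar_trivial_of_sum_ne_zero (P : Subgroup G) [Fintype P] (N : Subgroup P)
    [N.Normal] [Fintype N] {χ : G → ℂ} (hχ : χ ∈ irrChars G)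
    (hsum : ∑ n : N, χ ((n : P) : G) ≠ 0) :
    ∃ σ ∈ irrChars P, (∀ (n : N) (x : P), σ ((n : P) * x) = σ x) ∧
      classInner (fun x : P => χ x) σ ≠ 0 ∧
      ∃ d e : ℕ, χ 1 = d ∧ σ 1 = e ∧ d ≤ P.index * e := by
  classical
  have hχi : IsIrrChar G χ := hχ
  obtain ⟨V, _, _, _, ρ, hρ, hρχ⟩ := hχi
  -- the restrictions to `P` and `N`
  set ρP : Representation ℂ P V := ρ.comp P.subtype with hρP
  -- (1) `V^N ≠ ⊥`: `|N| · dim V^N = ∑_{n ∈ N} χ(n)`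
  have hW0 : Representation.invariants (ρP.comp N.subtype) ≠ ⊥ := by
    intro hbot
    apply hsum
    have hA : Set.MapsTo (LinearMap.id : V →ₗ[ℂ] V) ↑(Representation.invariants (ρP.comp N.subtype))
        ↑(Representation.invariants (ρP.comp N.subtype)) := fun v hv => hv
    have key := card_mul_trace_restrict_invariants ρP N LinearMap.id hA
    have htr : LinearMap.trace ℂ _ ((LinearMap.id : V →ₗ[ℂ] V).restrict hA) = 0 := by
      haveI : Subsingleton (Representation.invariants (ρP.comp N.subtype)) := by
        rw [hbot]
        infer_instance
      rw [Subsingleton.elim ((LinearMap.id : V →ₗ[ℂ] V).restrict hA) 0, map_zero]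
    rw [htr, mul_zero] at key
    calc ∑ n : N, χ ((n : P) : G) = ∑ j : N, LinearMap.trace ℂ V (LinearMap.id ∘ₗ ρP j) :=
        Finset.sum_congr rfl fun n _ => by rw [LinearMap.id_comp, ← hρχ]; rfl
      _ = 0 := key.symm
  set W : Submodule ℂ V := Representation.invariants (ρP.comp N.subtype) with hW
  -- (2) `W` is `P`-stable (`N ⊴ P`)
  have hstab : ∀ (x : P) (v : V), v ∈ W → ρP x v ∈ W := by
    intro x v hv
    rw [hW, Representation.mem_invariants] at hv ⊢
    intro n
    have hn : (x⁻¹ * (n : P) * x) ∈ N := by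
      have := ‹N.Normal›.conj_mem (n : P) n.2 x⁻¹
      simpa using this
    have hv' := hv ⟨x⁻¹ * (n : P) * x, hn⟩
    simp only [MonoidHom.coe_comp, Function.comp_apply, Subgroup.subtype_apply] at hv' ⊢
    calc ρP (n : P) (ρP x v) = ρP x (ρP (x⁻¹ * (n : P) * x) v) := by
          rw [← Module.End.mul_apply, ← map_mul, ← Module.End.mul_apply, ← map_mul]
          congr 2
          group
      _ = ρP x v := by rw [hv']
  let Wrep : Subrepresentation ρP :=
    { toSubmodule := W
      apply_mem_toSubmodule := fun x v hv => hstab x v hv }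
  -- (3) an irreducible `P`-subrepresentation `q ≤ W`
  haveI : Nontrivial Wrep.toSubmodule := Submodule.nontrivial_iff_ne_bot.mpr hW0
  obtain ⟨q, hq0, hqirr⟩ := Representation.exists_ne_bot_isIrreducible Wrep.toRepresentation
  set σ : P → ℂ := q.toRepresentation.character with hσ
  have hσi : IsIrrChar P σ := ⟨q.toSubmodule, _, _, inferInstance, q.toRepresentation, hqirr, rfl⟩
  -- (4) `σ` is trivial on `N`
  have hone : ∀ n : N, q.toRepresentation (n : P) = 1 := by
    intro n
    refine LinearMap.ext fun w => Subtype.ext (Subtype.ext ?_)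
    change ρP (n : P) ((w : Wrep.toSubmodule) : V) = ((w : Wrep.toSubmodule) : V)
    have hw : ((w : Wrep.toSubmodule) : V) ∈ W := (w : Wrep.toSubmodule).2
    rw [hW, Representation.mem_invariants] at hw
    exact hw n
  have htriv : ∀ (n : N) (x : P), σ ((n : P) * x) = σ x := by
    intro n x
    simp only [hσ, Representation.character, map_mul, hone n, one_mul]
  -- (5) `⟨Res_P χ, σ⟩ ≠ 0`: `Res_P χ = σ + (complement)`
  let f : Representation.IntertwiningMap q.toRepresentation ρP :=
    (Subrepresentation.subtypeIntertwiningMap Wrep).comp (Subrepresentation.subtypeIntertwiningMap q)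
  have hfinj : Function.Injective f := by
    intro w w' h
    apply Subtype.ext
    apply Subtype.ext
    exact h
  let e := Subrepresentation.equivRange f hfinj
  have hrange : f.range.toRepresentation.character = σ := by
    rw [hσ, Representation.char_iso e]
  obtain ⟨c, hc⟩ := exists_isCompl f.range
  have hres : (fun x : P => χ x) = σ + c.toRepresentation.character := by
    have h := Representation.character_eq_add_of_isCompl ρP f.range c hc
    rw [hrange] at h
    rw [← h, ← hρχ]
    rfl
  have hcchar : IsCharacter P c.toRepresentation.character :=
    ⟨c.toSubmodule, _, _, inferInstance, c.toRepresentation, rfl⟩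
  obtain ⟨k, hk⟩ := hcchar.classInner_irrChar_natCast hσi
  have hinner : classInner (fun x : P => χ x) σ = (1 + k : ℕ) := by
    rw [hres, classInner_add_left, hσi.classInner_eq hσi, if_pos rfl, hk]
    push_cast
    ring
  have hne : classInner (fun x : P => χ x) σ ≠ 0 := by
    rw [hinner]
    exact Nat.cast_ne_zero.mpr (by omega)
  exact ⟨σ, hσi, htriv, hne, apply_one_le_index_mul_of_classInner_ne_zero P hσi hχ hne⟩


/-! ### Representation-level form and inflation from a quotient `P ↠ L` -/

/-- **Fixed vectors give an irreducible `P`-representation on which `N` acts trivially** (the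
representation-level form of `exists_irrChar_trivial_of_sum_ne_zero`): under the same hypotheses
there is an irreducible representation `τ` of `P` with `τ(n) = 1` for all `n ∈ N` whose character
occurs in `Res_P χ`. (Serre §2.6, §1.4.) [folklore] -/
theorem exists_irreducible_trivial_of_sum_ne_zero (P : Subgroup G) [Fintype P] (N : Subgroup P)
    [N.Normal] [Fintype N] {χ : G → ℂ} (hχ : χ ∈ irrChars G)
    (hsum : ∑ n : N, χ ((n : P) : G) ≠ 0) :
    ∃ (W : Type) (_ : AddCommGroup W) (_ : Module ℂ W) (_ : FiniteDimensional ℂ W)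
      (τ : Representation ℂ P W), τ.IsIrreducible ∧ (∀ n : N, τ (n : P) = 1) ∧
        classInner (fun x : P => χ x) τ.character ≠ 0 := by
  classical
  have hχi : IsIrrChar G χ := hχ
  obtain ⟨V, _, _, _, ρ, hρ, hρχ⟩ := hχi
  set ρP : Representation ℂ P V := ρ.comp P.subtype with hρP
  have hW0 : Representation.invariants (ρP.comp N.subtype) ≠ ⊥ := by
    intro hbot
    apply hsum
    have hA : Set.MapsTo (LinearMap.id : V →ₗ[ℂ] V) ↑(Representation.invariants (ρP.comp N.subtype))
        ↑(Representation.invariants (ρP.comp N.subtype)) := fun v hv => hv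
    have key := card_mul_trace_restrict_invariants ρP N LinearMap.id hA
    have htr : LinearMap.trace ℂ _ ((LinearMap.id : V →ₗ[ℂ] V).restrict hA) = 0 := by
      haveI : Subsingleton (Representation.invariants (ρP.comp N.subtype)) := by
        rw [hbot]
        infer_instance
      rw [Subsingleton.elim ((LinearMap.id : V →ₗ[ℂ] V).restrict hA) 0, map_zero]
    rw [htr, mul_zero] at key
    calc ∑ n : N, χ ((n : P) : G) = ∑ j : N, LinearMap.trace ℂ V (LinearMap.id ∘ₗ ρP j) :=
        Finset.sum_congr rfl fun n _ => by rw [LinearMap.id_comp, ← hρχ]; rfl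
      _ = 0 := key.symm
  set W : Submodule ℂ V := Representation.invariants (ρP.comp N.subtype) with hW
  have hstab : ∀ (x : P) (v : V), v ∈ W → ρP x v ∈ W := by
    intro x v hv
    rw [hW, Representation.mem_invariants] at hv ⊢
    intro n
    have hn : (x⁻¹ * (n : P) * x) ∈ N := by
      have := ‹N.Normal›.conj_mem (n : P) n.2 x⁻¹
      simpa using this
    have hv' := hv ⟨x⁻¹ * (n : P) * x, hn⟩
    simp only [MonoidHom.coe_comp, Function.comp_apply, Subgroup.subtype_apply] at hv' ⊢
    calc ρP (n : P) (ρP x v) = ρP x (ρP (x⁻¹ * (n : P) * x) v) := by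
          rw [← Module.End.mul_apply, ← map_mul, ← Module.End.mul_apply, ← map_mul]
          congr 2
          group
      _ = ρP x v := by rw [hv']
  let Wrep : Subrepresentation ρP :=
    { toSubmodule := W
      apply_mem_toSubmodule := fun x v hv => hstab x v hv }
  haveI : Nontrivial Wrep.toSubmodule := Submodule.nontrivial_iff_ne_bot.mpr hW0
  obtain ⟨q, hq0, hqirr⟩ := Representation.exists_ne_bot_isIrreducible Wrep.toRepresentation
  set σ : P → ℂ := q.toRepresentation.character with hσ
  have hσi : IsIrrChar P σ := ⟨q.toSubmodule, _, _, inferInstance, q.toRepresentation, hqirr, rfl⟩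
  have hone : ∀ n : N, q.toRepresentation (n : P) = 1 := by
    intro n
    refine LinearMap.ext fun w => Subtype.ext (Subtype.ext ?_)
    change ρP (n : P) ((w : Wrep.toSubmodule) : V) = ((w : Wrep.toSubmodule) : V)
    have hw : ((w : Wrep.toSubmodule) : V) ∈ W := (w : Wrep.toSubmodule).2
    rw [hW, Representation.mem_invariants] at hw
    exact hw n
  let f : Representation.IntertwiningMap q.toRepresentation ρP :=
    (Subrepresentation.subtypeIntertwiningMap Wrep).comp (Subrepresentation.subtypeIntertwiningMap q)
  have hfinj : Function.Injective f := by
    intro w w' h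
    apply Subtype.ext
    apply Subtype.ext
    exact h
  let e := Subrepresentation.equivRange f hfinj
  have hrange : f.range.toRepresentation.character = σ := by
    rw [hσ, Representation.char_iso e]
  obtain ⟨c, hc⟩ := exists_isCompl f.range
  have hres : (fun x : P => χ x) = σ + c.toRepresentation.character := by
    have h := Representation.character_eq_add_of_isCompl ρP f.range c hc
    rw [hrange] at h
    rw [← h, ← hρχ]
    rfl
  have hcchar : IsCharacter P c.toRepresentation.character :=
    ⟨c.toSubmodule, _, _, inferInstance, c.toRepresentation, rfl⟩
  obtain ⟨k, hk⟩ := hcchar.classInner_irrChar_natCast hσi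
  have hinner : classInner (fun x : P => χ x) σ = (1 + k : ℕ) := by
    rw [hres, classInner_add_left, hσi.classInner_eq hσi, if_pos rfl, hk]
    push_cast
    ring
  have hne : classInner (fun x : P => χ x) σ ≠ 0 := by
    rw [hinner]
    exact Nat.cast_ne_zero.mpr (by omega)
  exact ⟨q.toSubmodule, _, _, inferInstance, q.toRepresentation, hqirr, hone, hne⟩

/-- **Inflation: an irreducible representation on which `ker π` acts trivially factors through
the surjection `π : P ↠ L`.**  If `π` is surjective and `τ` is an irreducible representation of
`P` with `τ(x) = 1` whenever `π(x) = 1`, then `τ = τ' ∘ π` for an irreducible representation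
`τ'` of `L` on the same space (Mathlib `MonoidHom.liftOfRightInverse`); on characters,
`χ_τ = σ' ∘ π` with `σ'` an irreducible character of `L` (Serre §1.3 / §3.3 Ex.; Isaacs Lemma 2.22).
[folklore] -/
theorem exists_irrChar_comp_of_surjective {P L : Type} [Group P] [Group L] (π : P →* L)
    (hπ : Function.Surjective π) {W : Type} [AddCommGroup W] [Module ℂ W] [FiniteDimensional ℂ W]
    (τ : Representation ℂ P W) (hτ : τ.IsIrreducible) (hker : ∀ x : P, π x = 1 → τ x = 1) :
    ∃ σ' ∈ irrChars L, τ.character = fun x => σ' (π x) := by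
  -- a set-theoretic section of `π` and the lift `τ' l = τ (s l)`
  set s := Function.surjInv hπ with hs
  have hsec : ∀ l, π (s l) = l := Function.surjInv_eq hπ
  have hconst : ∀ a b : P, π a = π b → τ a = τ b := by
    intro a b hab
    have h1 : τ (b⁻¹ * a) = 1 := hker _ (by rw [map_mul, map_inv, hab, inv_mul_cancel])
    calc τ a = τ (b * (b⁻¹ * a)) := by rw [mul_inv_cancel_left]
      _ = τ b := by rw [map_mul, h1, mul_one]
  let τ' : Representation ℂ L W :=
    { toFun := fun l => τ (s l)
      map_one' := by
        rw [hconst (s 1) 1 (by rw [hsec, map_one]), map_one]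
      map_mul' := fun l₁ l₂ => by
        rw [← map_mul]
        exact hconst _ _ (by rw [hsec, map_mul, hsec, hsec]) }
  have hτ' : ∀ x : P, τ' (π x) = τ x := fun x => hconst _ _ (hsec (π x))
  -- invariant subspaces of `τ'` are those of `τ`
  haveI := hτ
  let f : Subrepresentation τ' ≃o Subrepresentation τ :=
    { toFun := fun p => ⟨p.toSubmodule, fun x v hv => by
        have := p.apply_mem_toSubmodule (π x) hv
        rwa [hτ'] at this⟩
      invFun := fun p => ⟨p.toSubmodule, fun l v hv => by
        obtain ⟨x, rfl⟩ := hπ l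
        rw [hτ']
        exact p.apply_mem_toSubmodule x hv⟩
      left_inv := fun p => by ext; rfl
      right_inv := fun p => by ext; rfl
      map_rel_iff' := Iff.rfl }
  have hirr : τ'.IsIrreducible := f.isSimpleOrder
  refine ⟨τ'.character, ⟨W, _, _, inferInstance, τ', hirr, rfl⟩, ?_⟩
  funext x
  simp only [Representation.character, hτ']

/-- **Harish-Chandra's lemma, character form.**  Let `P ≤ G` be finite groups, `π : P ↠ L` a
surjective homomorphism (the model: `P` a parabolic subgroup, `L` its Levi quotient, `ker π` the
unipotent radical) and `χ` an irreducible character of `G` with `∑_{u ∈ ker π} χ(u) ≠ 0` (a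
non-zero vector fixed under `ker π`).  Then there is an irreducible character `σ'` of `L` whose
inflation `σ' ∘ π` occurs in `Res_P χ`, and `χ(1) ≤ [G : P] · σ'(1)` (degrees as natural numbers).
(Carter, *Finite Groups of Lie Type*, §9.1; Serre §7.2.) [folklore] -/
theorem exists_irrChar_quotient_of_sum_ker_ne_zero (P : Subgroup G) [Fintype P] {L : Type} [Group L]
    [DecidableEq L] (π : P →* L) (hπ : Function.Surjective π) {χ : G → ℂ} (hχ : χ ∈ irrChars G)
    (hsum : ∑ n : π.ker, χ ((n : P) : G) ≠ 0) :
    ∃ σ' ∈ irrChars L, classInner (fun x : P => χ x) (fun x => σ' (π x)) ≠ 0 ∧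
      ∃ d e : ℕ, χ 1 = d ∧ σ' 1 = e ∧ d ≤ P.index * e := by
  classical
  obtain ⟨W, _, _, _, τ, hτ, hone, hne⟩ := exists_irreducible_trivial_of_sum_ne_zero P π.ker hχ hsum
  have hker : ∀ x : P, π x = 1 → τ x = 1 := fun x hx => hone ⟨x, (MonoidHom.mem_ker).mpr hx⟩
  obtain ⟨σ', hσ', hchar⟩ := exists_irrChar_comp_of_surjective π hπ τ hτ hker
  have hτi : IsIrrChar P τ.character := ⟨W, _, _, inferInstance, τ, hτ, rfl⟩
  rw [hchar] at hne hτi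
  obtain ⟨d, e, hd, he, hle⟩ := apply_one_le_index_mul_of_classInner_ne_zero P hτi hχ hne
  refine ⟨σ', hσ', hne, d, e, hd, ?_, hle⟩
  rw [← he, map_one]

end Literature.RepresentationTheory.FiniteGroups

end
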